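import Summits.CriticalPhenomena.CardyFormulaZ2.Theorems.CardyFlipRussoVoronoiHubFromSmirnovDefs

/-!
# Stub `poisson_voidBall_unionBound` of line `moebius-exact-delaunay-dilation-ward`
# (crux `VoronoiHubFromSmirnov`, stmt-CriticalPhenomena-6433)

Void balls are rare for a planar Poisson process of Lebesgue intensity (the core union bound of
I. Benjamini, O. Schramm, *Conformal invariance of Voronoi percolation*, Comm. Math. Phys. 197
(1998) 75–107, Lemma 5.5 "no giant tiles"): if a set `A ⊆ ℂ` is covered by the balls
`B(x, s/3)`, `x ∈ X` (`X` finite), then the probability that some point `z ∈ A` has no Poisson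
nucleus within distance `< s` is at most `|X| · exp(-π (s/3)²)`.

Proof.
* Inclusion `{c | ∃ z ∈ A, ∀ q ∈ c, s ≤ dist q z} ⊆ ⋃_{x ∈ X} {c | N_c(B(x, s/3)) = 0}`: pick
  `x ∈ X` with `z ∈ B(x, s/3)`; a nucleus `q ∈ c ∩ B(x, s/3)` would satisfy
  `dist q z ≤ dist q x + dist x z < 2s/3 < s`, contradicting `s ≤ dist q z`.
* Monotonicity and the finite union bound for `Measure.real` (`measureReal_mono`,
  `measureReal_biUnion_finset_le`; `P` is a probability measure).
* Each term is the void probability `P(N(B(x, s/3)) = 0) = exp(-|B(x, s/3)|) = exp(-π (s/3)²)`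
  (`IsPoissonPointProcess.measureReal_count_eq_zero`, PROVED in
  `Literature.Analysis.FunctionSpaces.PoissonMecke`; `Complex.volume_ball`).

No new definitions; tree facts and Mathlib only.
-/

noncomputable section

namespace Summit.CriticalPhenomena.CardyFormulaZ2.Cruxes.VoronoiHubFromSmirnov.MoebiusExactDelaunayDilationWard

open MeasureTheory Literature.Analysis.FunctionSpaces
open scoped ENNReal NNReal

/-- Deterministic inclusion: if `A` is covered by the balls `B(x, s/3)`, `x ∈ X`, then a
configuration leaving some `z ∈ A` at distance `≥ s` from all its points has no point in one of
the balls `B(x, s/3)` (triangle inequality). -/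
theorem vb_voidSet_subset (A : Set ℂ) (X : Finset ℂ) (s : ℝ)
    (hAX : A ⊆ ⋃ x ∈ X, Metric.ball x (s / 3)) :
    {c : PointConfig ℂ | ∃ z ∈ A, ∀ q ∈ c, s ≤ dist q z} ⊆
      ⋃ x ∈ X, {c : PointConfig ℂ | c.count (Metric.ball x (s / 3)) = 0} := by
  rintro c ⟨z, hzA, hz⟩
  obtain ⟨x, hxX, hzx⟩ := Set.mem_iUnion₂.mp (hAX hzA)
  refine Set.mem_iUnion₂.mpr ⟨x, hxX, ?_⟩
  simp only [Set.mem_setOf_eq, PointConfig.count, Set.encard_eq_zero,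
    Set.eq_empty_iff_forall_notMem]
  rintro q ⟨hqc, hqx⟩
  have h1 : s ≤ dist q z := hz q hqc
  have h2 : dist q z ≤ dist q x + dist x z := dist_triangle q x z
  rw [Metric.mem_ball] at hqx hzx
  have h3 : dist x z = dist z x := dist_comm x z
  have h4 : 0 ≤ dist z x := dist_nonneg
  linarith

/-- The area of a planar disc of radius `r ≥ 0`, as a real number: `|B(x, r)| = π r²`
(`Complex.volume_ball`). -/
theorem vb_volume_ball_toReal (x : ℂ) {r : ℝ} (hr : 0 ≤ r) :
    (volume (Metric.ball x r)).toReal = Real.pi * r ^ 2 := by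
  rw [Complex.volume_ball, ENNReal.toReal_mul, ENNReal.toReal_pow, ENNReal.toReal_ofReal hr,
    ENNReal.coe_toReal, NNReal.coe_real_pi]
  ring

/-- **Void balls are rare** (Benjamini–Schramm 1998, core of Lemma 5.5): for a Poisson process
`P` of Lebesgue intensity on `ℂ`, a finite set of centres `X` and `A ⊆ ⋃_{x ∈ X} B(x, s/3)`
(`s > 0`), the probability that some `z ∈ A` has all nuclei at distance `≥ s` is at most
`|X| · exp(-π (s/3)²)` (union bound over the void events of the balls `B(x, s/3)`). -/
theorem poisson_voidBall_unionBound : ∀ {P : MeasureTheory.Measure (Literature.Analysis.FunctionSpaces.PointConfig ℂ)}, Literature.Analysis.FunctionSpaces.IsPoissonPointProcess (MeasureTheory.volume : MeasureTheory.Measure ℂ) P → ∀ (A : Set ℂ) (X : Finset ℂ) (s : ℝ), 0 < s → A ⊆ ⋃ x ∈ X, Metric.ball x (s / 3) → P.real {c | ∃ z ∈ A, ∀ q ∈ c, s ≤ dist q z} ≤ X.card * Real.exp (-(Real.pi * (s / 3) ^ 2)) := by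
  intro P hP A X s hs hAX
  haveI := hP.isProbabilityMeasure
  calc P.real {c | ∃ z ∈ A, ∀ q ∈ c, s ≤ dist q z}
      ≤ P.real (⋃ x ∈ X, {c : PointConfig ℂ | c.count (Metric.ball x (s / 3)) = 0}) :=
        measureReal_mono (vb_voidSet_subset A X s hAX) (measure_ne_top _ _)
    _ ≤ ∑ x ∈ X, P.real {c : PointConfig ℂ | c.count (Metric.ball x (s / 3)) = 0} :=
        measureReal_biUnion_finset_le _ _
    _ = ∑ x ∈ X, Real.exp (-(Real.pi * (s / 3) ^ 2)) := by
        refine Finset.sum_congr rfl fun x _ => ?_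
        rw [hP.measureReal_count_eq_zero Metric.isOpen_ball.measurableSet measure_ball_lt_top.ne,
          vb_volume_ball_toReal x (by positivity : (0 : ℝ) ≤ s / 3)]
    _ = X.card * Real.exp (-(Real.pi * (s / 3) ^ 2)) := by
        rw [Finset.sum_const, nsmul_eq_mul]

end Summit.CriticalPhenomena.CardyFormulaZ2.Cruxes.VoronoiHubFromSmirnov.MoebiusExactDelaunayDilationWard

end
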